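import Literature.MathematicalPhysics.QuantumFieldTheory.Balaban1983to89.LatticeFieldCalculus

/-!
# `Balaban1983to89.B6Eq294Scaling` — T. Bałaban, *Propagators and renormalization transformations for lattice gauge
theories. II*, Commun. Math. Phys. **96** (1984) 223–250 [Balaban1984PropagatorsII]: the rescaling rule **(2.94)** p. 239
for propagator kernels between the `η`-lattice and the `ξ = L^{−j}`-lattice, PROVED on the torus calculus of
`…LatticeFieldCalculus`

statement-level skeleton of published theorems with citation tags; proofs where landed; nothing here is a claim about the Yang–Mills mass gap.
PDF held: `paper:balaban1984-cmp96-propagators-rt-ii` (journal page = PDF page + 222); p. 239 [PDF 17] read from the ×2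
render `run/shared/lean/pub/pub-balaban/b2b-balaban-ref1/pages/1984-cmp96-propagators-rt-II/1984-cmp96-propagators-rt-II-p017-x2.png`.

CITATION HEADER (cell `lit-balaban`, unit `lit-balaban-r03` gen 2 — B6 reader; SKELETON row `B6.Eq2.94` of
`HOME/lit-balaban-r03/ROWS-B6.md`, a G.2(b) knitting identity announced `TAKING B6.Eq2.94` in HOME/STATUS.md).
IMPORTED, not modified: `…LatticeFieldCalculus` (the differences `pdiff c`/`pdiffAdj c`, gradient `grad c`, Laplacian
`laplace c` with the inverse lattice spacing `c` as an explicit real parameter, on the tori `Site P j`).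
WHAT THE PAPER PRINTS (p. 239 [PDF 17], after (2.93), verbatim): *"At first we rescale G_□ from η-lattice to
L^{−j}-lattice. Of course we have G^η_□(L^jηb, L^jηb′) = (L^jη)^{−d+2}G^ξ_□(b, b′), b, b′ ∈ T_□ ⊂ L^{−j}Z^d, (2.94) and
correspondingly for derivatives of G_□. This follows from the scaling laws for the operators defining G_□ that G^ξ_□ is
defined by the same formula (2.90) with η"* [replaced by ξ; continued on p. 240] (`G_□ = (Δ − ∂P_□∂* + Q*aQ)⁻¹`, (2.90)).
READING.  The `η`-lattice and the `ξ`-lattice are the SAME set of sites with two bookkeeping spacings, `η` and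
`ξ = L^{−j}`, ratio `s := L^jη = η/ξ` (the `η`-site `L^jηb` IS the `ξ`-site `b`); a kernel of an operator `T` is taken
with respect to the lattice pairing of its scale, `(Tf)(x) = Σ_{x′} w·T(x,x′)f(x′)` with `w = η^d` resp. `ξ^d = s^{−d}η^d`
(`kernel`, `apply_eq_sum_kernel`).  Since `∂^η = s^{−1}∂^ξ` and `Δ^η = s^{−2}Δ^ξ` (`pdiff_scale`, `laplace_scale`: the
calculus is homogeneous in `c = spacing⁻¹`, `c_η = c_ξ/s`), an inverse `G^ξ` of `Δ^ξ` (on any invariant subspace, with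
any boundary condition expressed through the operator) gives the inverse `G^η = s²G^ξ` of `Δ^η` (`inverse_scale`), and
the kernels then satisfy (2.94): `G^η(x,x′) = s^{2−d}G^ξ(x,x′)` (`kernel_scale`, `eq294`), and for one derivative
`(∂^ηG^η)(x,x′) = s^{1−d}(∂^ξG^ξ)(x,x′)` (`eq294_grad`) — *"and correspondingly for derivatives of G_□"*.
WHAT IS PROVED HERE (0 sorry, 0 named facts): the homogeneity lemmas, the kernel bookkeeping, `inverse_scale`, and
(2.94) with its derivative form, for ARBITRARY linear operators related by `G^η = s²G^ξ` (so in particular for every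
`G_□`, whatever the boundary condition).  NOT modelled: the specific operators `G_□` of (2.90)–(2.93).
v1.1 (APPEND-ONLY, r03 gen 5, row `B6.Eq2.133`): §4 = (2.133) p. 247, the two sup entries of Proposition 2.5 for `G^ξ_□`
transported to `G^η_□ = (L^jη)²G^ξ_□` with the factors `(L^jη)²`, `L^jη` and the exponent `δ₂(L^jη)^{−1}dist` (`ineq2133_sup`,
`ineq2133_grad`; the (1.110)-shape bounds are displayed hypotheses).
-/

namespace Literature.MathematicalPhysics.QuantumFieldTheory.Balaban1983to89.B6Eq294Scaling

open Finset
open LatticeFieldCalculus (pdiff pdiffAdj grad laplace)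

variable {P : Params} {j : ℕ}

/-! ## §1. Homogeneity of the lattice calculus in the inverse spacing `c` -/

/-- `∂^{(c/s)}_μ = s^{−1}·∂^{(c)}_μ`, written multiplicatively: `pdiff (c·t) = t·pdiff c` (`t = s^{−1}`).
[cite: Balaban1984PropagatorsI, (1.2) p.18] -/
theorem pdiff_scale (c t : ℝ) (μ : Fin P.d) (f : SiteField P j ℝ) :
    pdiff (c * t) μ f = t • pdiff c μ f := by
  funext x
  simp only [pdiff, Pi.smul_apply, smul_eq_mul]
  ring

/-- `∂*` scales the same way. [cite: Balaban1984PropagatorsI, (1.21) p.21] -/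
theorem pdiffAdj_scale (c t : ℝ) (μ : Fin P.d) (f : SiteField P j ℝ) :
    pdiffAdj (c * t) μ f = t • pdiffAdj c μ f := by
  funext x
  simp only [pdiffAdj, Pi.smul_apply, smul_eq_mul]
  ring

/-- the gradient scales the same way. [cite: Balaban1984PropagatorsI, (1.4) p.18] -/
theorem grad_scale (c t : ℝ) (f : SiteField P j ℝ) : grad (c * t) f = t • grad c f := by
  funext b
  simp only [grad, Pi.smul_apply, smul_eq_mul]
  ring

/-- **`Δ^{(c·t)} = t²·Δ^{(c)}`** — with `c_η = c_ξ/s`: `Δ^η = s^{−2}Δ^ξ`. [cite: Balaban1984PropagatorsII, (2.94) p.239] -/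
theorem laplace_scale (c t : ℝ) (f : SiteField P j ℝ) : laplace (c * t) f = (t ^ 2) • laplace c f := by
  funext x
  simp only [laplace, Pi.smul_apply, smul_eq_mul, Finset.mul_sum]
  refine Finset.sum_congr rfl fun μ _ => ?_
  ring

/-! ## §2. Kernels with respect to a lattice pairing, and the inverse on the two scales -/

/-- the kernel of a linear operator `T` on site functions with respect to the pairing weight `w` (`= η^d` on the
`η`-lattice): `T(x,x′) := w⁻¹·(Tδ_{x′})(x)`, so that `(Tf)(x) = Σ_{x′} w·T(x,x′)f(x′)` (`apply_eq_sum_kernel`).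
[cite: Balaban1984PropagatorsII, (2.150) p.249] -/
noncomputable def kernel (w : ℝ) (T : Module.End ℝ (SiteField P j ℝ)) (x x' : Site P j) : ℝ :=
  w⁻¹ * T (Pi.single x' 1) x

/-- `(Tf)(x) = Σ_{x′} w·T(x,x′)·f(x′)` for `w ≠ 0`. [cite: Balaban1984PropagatorsII, (2.150) p.249] -/
theorem apply_eq_sum_kernel {w : ℝ} (hw : w ≠ 0) (T : Module.End ℝ (SiteField P j ℝ)) (f : SiteField P j ℝ)
    (x : Site P j) : T f x = ∑ x' : Site P j, w * kernel w T x x' * f x' := by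
  classical
  have hf : f = ∑ x' : Site P j, f x' • (Pi.single x' (1 : ℝ) : SiteField P j ℝ) := by
    funext y
    simp only [Finset.sum_apply, Pi.smul_apply, Pi.single_apply, smul_eq_mul, mul_ite, mul_one, mul_zero,
      Finset.sum_ite_eq, Finset.mem_univ, if_true]
  conv_lhs => rw [hf]
  simp only [map_sum, map_smul, Finset.sum_apply, Pi.smul_apply, smul_eq_mul, kernel]
  refine Finset.sum_congr rfl fun x' _ => ?_
  field_simp

/-- **The inverse on the two scales.**  If `Δ^η = s^{−2}Δ^ξ` on site functions (as for `laplace (c/s)` vs `laplace c`,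
`laplace_scale`) and `G^ξ` is a right inverse of `Δ^ξ` on a subspace `N` (any boundary condition∕restriction being part of
the operators), then `G^η := s²G^ξ` is a right inverse of `Δ^η` on `N`. [cite: Balaban1984PropagatorsII, (2.94) p.239] -/
theorem inverse_scale (Dxi Deta Gxi : Module.End ℝ (SiteField P j ℝ)) (N : Submodule ℝ (SiteField P j ℝ)) {s : ℝ}
    (hs : s ≠ 0) (hD : Deta = (s ^ 2)⁻¹ • Dxi) (hG : ∀ f ∈ N, Dxi (Gxi f) = f) :
    ∀ f ∈ N, Deta (((s ^ 2) • Gxi) f) = f := by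
  intro f hf
  rw [hD, LinearMap.smul_apply, LinearMap.smul_apply, map_smul, hG f hf, smul_smul, inv_mul_cancel₀ (pow_ne_zero 2 hs),
    one_smul]

/-- `laplace (c/s) = s^{−2}·laplace c` as linear endomorphisms (the hypothesis `hD` of `inverse_scale` for the Laplacian
itself). [cite: Balaban1984PropagatorsII, (2.94) p.239] -/
theorem laplace_end_scale (c s : ℝ) (Dxi Deta : Module.End ℝ (SiteField P j ℝ))
    (hxi : ∀ f, Dxi f = laplace c f) (heta : ∀ f, Deta f = laplace (c / s) f) : Deta = (s ^ 2)⁻¹ • Dxi := by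
  refine LinearMap.ext fun f => ?_
  rw [heta, LinearMap.smul_apply, hxi, div_eq_mul_inv, laplace_scale, inv_pow]

/-! ## §3. (2.94) -/

/-- **Kernel bookkeeping between the scales**: for operators related by `G^η = s^a·G^ξ` and pairing weights
`w_η = s^d·w_ξ` (`η^d = (L^jη)^d ξ^d`), `G^η(x,x′) = s^{a}·s^{−d}·G^ξ(x,x′)`. [cite: Balaban1984PropagatorsII, (2.94) p.239] -/
theorem kernel_scale (Gxi : Module.End ℝ (SiteField P j ℝ)) (s wxi : ℝ) (a : ℤ) (d : ℕ) (x x' : Site P j) :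
    kernel (s ^ d * wxi) ((s ^ a) • Gxi) x x' = s ^ a * (s ^ d)⁻¹ * kernel wxi Gxi x x' := by
  simp only [kernel, LinearMap.smul_apply, Pi.smul_apply, smul_eq_mul, mul_inv]
  ring

/-- **(2.94)**: `G^η_□(L^jηb, L^jηb′) = (L^jη)^{−d+2}G^ξ_□(b,b′)` — for `G^η = s²G^ξ`, `s = L^jη`, kernels taken with
respect to the pairings of their scales (`w_η = η^d = s^d·ξ^d = s^d·w_ξ`). [cite: Balaban1984PropagatorsII, (2.94) p.239] -/
theorem eq294 (Gxi : Module.End ℝ (SiteField P j ℝ)) {s : ℝ} (wxi : ℝ) (hs : 0 < s) (d : ℕ) (x x' : Site P j) :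
    kernel (s ^ d * wxi) ((s ^ 2) • Gxi) x x' = s ^ ((2 : ℤ) - d) * kernel wxi Gxi x x' := by
  have h := kernel_scale Gxi s wxi 2 d x x'
  rw [zpow_ofNat] at h
  rw [h, zpow_sub₀ hs.ne', zpow_ofNat, zpow_natCast, div_eq_mul_inv]

/-- **(2.94) for one derivative** (*"and correspondingly for derivatives of G_□"*): with `∂^η = s^{−1}∂^ξ`
(`pdiff_scale`), `(∂^η_μG^η)(x,x′) = (L^jη)^{−d+1}(∂^ξ_μG^ξ)(x,x′)`; here `∂^ξ_μG^ξ` is any operator `DG` and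
`∂^η_μG^η = s^{−1}·s²·DG = s·DG`. [cite: Balaban1984PropagatorsII, (2.94) p.239] -/
theorem eq294_grad (DGxi : Module.End ℝ (SiteField P j ℝ)) {s : ℝ} (wxi : ℝ) (hs : 0 < s) (d : ℕ)
    (x x' : Site P j) :
    kernel (s ^ d * wxi) (s⁻¹ • ((s ^ 2) • DGxi)) x x' = s ^ ((1 : ℤ) - d) * kernel wxi DGxi x x' := by
  have hss : s⁻¹ • ((s ^ 2) • DGxi) = (s ^ (1 : ℤ)) • DGxi := by
    rw [smul_smul, zpow_one, pow_two, ← mul_assoc, inv_mul_cancel₀ hs.ne', one_mul]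
  rw [hss, kernel_scale DGxi s wxi 1 d x x', zpow_sub₀ hs.ne', zpow_natCast, div_eq_mul_inv]

/-- the composite `∂^η_μ ∘ G^η` really is `s^{−1}·(∂^ξ_μ ∘ G^ξ)` scaled by `s²`, i.e. `s·(∂^ξ_μ ∘ G^ξ)`, when `G^η = s²G^ξ`
and `c_η = c_ξ/s` (pointwise form used to instantiate `eq294_grad`). [cite: Balaban1984PropagatorsII, (2.94) p.239] -/
theorem pdiff_comp_scale (c : ℝ) {s : ℝ} (hs : s ≠ 0) (μ : Fin P.d) (Gxi : Module.End ℝ (SiteField P j ℝ))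
    (f : SiteField P j ℝ) :
    pdiff (c / s) μ (((s ^ 2) • Gxi) f) = s • pdiff c μ (Gxi f) := by
  rw [div_eq_mul_inv, pdiff_scale, LinearMap.smul_apply]
  funext x
  simp only [pdiff, Pi.smul_apply, smul_eq_mul]
  field_simp

/-! ## §4. (2.133): the sup bounds of Proposition 2.5 rescaled back to the `η`-scale (v1.1, APPEND-ONLY, unit
`lit-balaban-r03` gen 5; SKELETON row `B6.Eq2.133`)

p. 247 [PDF 25], verbatim (render `…-p025-x2.png` re-read as an image): *"Now let us come back to the equality (2.91). At first
we will formulate the relevant inequalities for G_□ rescaled back to η-scale. We have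
|(G_□J)(x)|, |(∇G_□J)(x)| ≤ O(1)[(L^jη)², L^jη]e^{−δ₂(L^jη)^{−1}dist(Δ,Δ′)}|J|, (2.133) for x ∈ Δ(y), supp J ⊂ Δ(y′), y, y′ ∈
𝔅∩T_□."*  READING: (2.133) is the pair of sup entries of Proposition 2.5 (= [Balaban1984PropagatorsI] (1.110) for `G^ξ_□` with
the rate `δ₂`, on the `ξ = L^{−j}`-lattice where the blocks `Δ` are unit cubes and the distance is the `ξ`-distance) transported
to `G^η_□ = s²G^ξ_□`, `s = L^jη` (§2–§3 above): the operator picks up `s²`, one `η`-derivative `∂^η = s^{−1}∂^ξ` costs `s^{−1}`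
(`pdiff_comp_scale`), and the `ξ`-distance IS `(L^jη)^{−1}`× the `η`-distance.  Typed for an ARBITRARY family of regions
`Δ : Y → Set (sites)` (the blocks) with a distance `ρ_η = s·ρ_ξ` on the labels; the (1.110)-shape bounds for `G^ξ` are the
displayed hypotheses (Proposition 2.5 itself is NOT proved here). -/

/-- **(2.133), first entry**: if `|(G^ξJ)(x)| ≤ C·e^{−δ₂ρ_ξ(y,y′)}·M` for `x ∈ Δ(y)`, `supp J ⊂ Δ(y′)`, `|J| ≤ M` (the first entry
of (1.110) for `G^ξ_□`, Prop. 2.5), then `G^η = s²G^ξ` satisfies `|(G^ηJ)(x)| ≤ C·s²·e^{−δ₂s^{−1}ρ_η(y,y′)}·M` — the printed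
`O(1)(L^jη)²e^{−δ₂(L^jη)^{−1}dist(Δ,Δ′)}|J|`. [cite: Balaban1984PropagatorsII, (2.133) p.247] -/
theorem ineq2133_sup (Gxi : Module.End ℝ (SiteField P j ℝ)) {s : ℝ} (hs : 0 < s) {Y : Type*}
    (Δ : Y → Set (Site P j)) (ρxi ρeta : Y → Y → ℝ) (hρ : ∀ y y', ρeta y y' = s * ρxi y y') {C δ₂ : ℝ}
    (h110 : ∀ (y y' : Y) (J : SiteField P j ℝ) (M : ℝ), (∀ x, J x ≠ 0 → x ∈ Δ y') → (∀ x, |J x| ≤ M) →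
      ∀ x ∈ Δ y, |Gxi J x| ≤ C * Real.exp (-(δ₂ * ρxi y y')) * M)
    (y y' : Y) (J : SiteField P j ℝ) (M : ℝ) (hJ : ∀ x, J x ≠ 0 → x ∈ Δ y') (hM : ∀ x, |J x| ≤ M)
    (x : Site P j) (hx : x ∈ Δ y) :
    |((s ^ 2) • Gxi) J x| ≤ C * s ^ 2 * Real.exp (-(δ₂ * s⁻¹ * ρeta y y')) * M := by
  have hdist : δ₂ * s⁻¹ * ρeta y y' = δ₂ * ρxi y y' := by
    rw [hρ y y']
    field_simp
  rw [hdist, LinearMap.smul_apply, Pi.smul_apply, smul_eq_mul, abs_mul, abs_of_pos (pow_pos hs 2)]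
  calc s ^ 2 * |Gxi J x| ≤ s ^ 2 * (C * Real.exp (-(δ₂ * ρxi y y')) * M) :=
        mul_le_mul_of_nonneg_left (h110 y y' J M hJ hM x hx) (pow_pos hs 2).le
    _ = C * s ^ 2 * Real.exp (-(δ₂ * ρxi y y')) * M := by ring

/-- **(2.133), second entry** (*"and correspondingly for derivatives of G_□"*, p. 239): if `|(∂^ξ_μG^ξJ)(x)| ≤ C·e^{−δ₂ρ_ξ(y,y′)}·M`
under the same support/sup hypotheses (the second entry of (1.110) for `G^ξ_□`), then with `∂^η_μ = s^{−1}∂^ξ_μ` (`c_η = c_ξ/s`,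
`pdiff_comp_scale`) `|(∂^η_μG^ηJ)(x)| ≤ C·s·e^{−δ₂s^{−1}ρ_η(y,y′)}·M` — the printed `O(1)(L^jη)e^{−δ₂(L^jη)^{−1}dist(Δ,Δ′)}|J|`.
[cite: Balaban1984PropagatorsII, (2.133) p.247] -/
theorem ineq2133_grad (c : ℝ) (μ : Fin P.d) (Gxi : Module.End ℝ (SiteField P j ℝ)) {s : ℝ} (hs : 0 < s) {Y : Type*}
    (Δ : Y → Set (Site P j)) (ρxi ρeta : Y → Y → ℝ) (hρ : ∀ y y', ρeta y y' = s * ρxi y y') {C δ₂ : ℝ}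
    (h110 : ∀ (y y' : Y) (J : SiteField P j ℝ) (M : ℝ), (∀ x, J x ≠ 0 → x ∈ Δ y') → (∀ x, |J x| ≤ M) →
      ∀ x ∈ Δ y, |pdiff c μ (Gxi J) x| ≤ C * Real.exp (-(δ₂ * ρxi y y')) * M)
    (y y' : Y) (J : SiteField P j ℝ) (M : ℝ) (hJ : ∀ x, J x ≠ 0 → x ∈ Δ y') (hM : ∀ x, |J x| ≤ M)
    (x : Site P j) (hx : x ∈ Δ y) :
    |pdiff (c / s) μ (((s ^ 2) • Gxi) J) x| ≤ C * s * Real.exp (-(δ₂ * s⁻¹ * ρeta y y')) * M := by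
  have hdist : δ₂ * s⁻¹ * ρeta y y' = δ₂ * ρxi y y' := by
    rw [hρ y y']
    field_simp
  rw [hdist, pdiff_comp_scale c hs.ne' μ Gxi J, Pi.smul_apply, smul_eq_mul, abs_mul, abs_of_pos hs]
  calc s * |pdiff c μ (Gxi J) x| ≤ s * (C * Real.exp (-(δ₂ * ρxi y y')) * M) :=
        mul_le_mul_of_nonneg_left (h110 y y' J M hJ hM x hx) hs.le
    _ = C * s * Real.exp (-(δ₂ * ρxi y y')) * M := by ring

end Literature.MathematicalPhysics.QuantumFieldTheory.Balaban1983to89.B6Eq294Scaling
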